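import Literature.Computability.QuantumComplexity.IQPForrelation

/-!
# Crux `CubicForrelation.SignedExactCubicForrelationNotPrBPP` (stmt-QuantumAdvantage-13932) — stub `stub_spanHalf`

Stub `stub_spanHalf` of line `dual-pingpong-frame` (GROW reshape, kernel statistics in the radical-visible case):
**spanning probe tuples are the majority.** At most half of the `(n+1)`-tuples `xs` of vectors of `𝔽₂ⁿ` have a
common NON-ZERO annihilator `w` (`w · xs j = 0` for all `j`, inner products spelled
`(univ.filter fun i => wᵢ ∧ (xs j)ᵢ).card.bodd`):
`2 · #{xs | ∃ w ≠ 0, ∀ j, w · xs j = 0} ≤ 2^{n(n+1)} = #(𝔽₂ⁿ)^{n+1}`.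

Proof: the filter is the tree's acceptance predicate `Simon.MissesBasis` of Simon's decision procedure with
`k = n + 1` samples (bridge `n % 2 = n.bodd.toNat`, `Nat.mod_two_of_bodd`), whose union bound
`Simon.card_filter_missesBasis_le` gives `#{…} ≤ (2ⁿ − 1) · 2^{(n−1)(n+1)}` (each of the `2ⁿ − 1` non-zero `w`
annihilates exactly the tuples inside the hyperplane `w^⊥` of size `2^{n−1}`); and
`2 · (2ⁿ − 1) · 2^{(n−1)(n+1)} ≤ 2 · 2ⁿ · 2^{n² − 1} = 2^{n(n+1)}` for `n ≥ 1` (`two_mul_missesBasis_bound_le`), while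
for `n = 0` there is no non-zero `w` and the left side is `0`. No definitions.

References: D. R. Simon, *On the power of quantum computation*, FOCS 1994, §3.1 (the samples "contain a basis" with
probability `1 − 2^{…}`: the union bound over non-zero orthogonal vectors) [Simon1994].
-/

noncomputable section

set_option linter.dupNamespace false -- D-0017: single-problem summit ⇒ `QuantumAdvantage.QuantumAdvantage` by design

namespace Summit.QuantumAdvantage.QuantumAdvantage.Theorems.SignedExactCubicForrelationNotPrBPP

open Finset
open Literature.Computability.Complexity Literature.Computability.QuantumComplexity
open Literature.Computability.QuantumComplexity.BuzetChailloux (bxor zeroVec)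

namespace SpanHalf

/-- The tuples with a common non-zero annihilator (inner products as `card.bodd`) are among the tuples accepted by
Simon's predicate `MissesBasis` (inner products as `Even card`, bridge `n % 2 = n.bodd.toNat`); in fact the two filters
coincide. [cite: Simon1994, §3.1] -/
theorem filter_subset_missesBasis (n k : ℕ) :
    (univ.filter fun xs : Fin k → (Fin n → Bool) =>
        ∃ w : Fin n → Bool, w ≠ zeroVec ∧ ∀ j, ((univ.filter fun i => w i && xs j i).card).bodd = false) ⊆
      univ.filter fun xs : Fin k → Fin n → Bool => Simon.MissesBasis xs := by
  intro xs hxs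
  obtain ⟨w, hw, hj⟩ := (mem_filter.1 hxs).2
  exact mem_filter.2 ⟨mem_univ _, w, hw, fun j => Nat.even_iff.2 (by rw [Nat.mod_two_of_bodd, hj j]; rfl)⟩

/-- The arithmetic of the union bound: `2 · (2ⁿ − 1) · 2^{(n−1)(n+1)} ≤ 2^{n(n+1)}` (for `n ≥ 1` bound `2ⁿ − 1 ≤ 2ⁿ` and
use `1 + n + (n−1)(n+1) = n(n+1)`; for `n = 0` the left side is `0`). [folklore] -/
theorem two_mul_missesBasis_bound_le (n : ℕ) :
    2 * ((2 ^ n - 1) * 2 ^ ((n - 1) * (n + 1))) ≤ 2 ^ (n * (n + 1)) := by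
  cases n with
  | zero => simp
  | succ m =>
    rw [Nat.add_sub_cancel]
    calc 2 * ((2 ^ (m + 1) - 1) * 2 ^ (m * (m + 1 + 1)))
        ≤ 2 * (2 ^ (m + 1) * 2 ^ (m * (m + 1 + 1))) :=
          Nat.mul_le_mul_left 2 (Nat.mul_le_mul_right _ (Nat.sub_le _ _))
      _ = 2 ^ ((m + 1) * (m + 1 + 1)) := by
          rw [← pow_add, ← pow_succ']
          congr 1
          ring

end SpanHalf

open SpanHalf

/-- **Spanning tuples are the majority** (stub `stub_spanHalf` of line `dual-pingpong-frame`, crux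
stmt-QuantumAdvantage-13932): at most half of the `(n+1)`-tuples of vectors of `𝔽₂ⁿ` have a common non-zero
annihilator, `2 · #{xs | ∃ w ≠ 0, ∀ j, w · xs j = 0} ≤ 2^{n(n+1)}`. Union bound over the `2ⁿ − 1` non-zero `w`
(`Simon.card_filter_missesBasis_le` with `k = n + 1`) and `2 · (2ⁿ − 1) · 2^{(n−1)(n+1)} ≤ 2^{n(n+1)}`.
[cite: Simon1994, §3.1] -/
theorem stub_spanHalf :
    ∀ n : ℕ, 2 * (Finset.univ.filter fun xs : Fin (n + 1) → (Fin n → Bool) =>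
        ∃ w : Fin n → Bool, w ≠ zeroVec ∧ ∀ j, ((Finset.univ.filter fun i => w i && xs j i).card).bodd = false).card
      ≤ 2 ^ (n * (n + 1)) :=
  fun n => (Nat.mul_le_mul_left 2 ((card_le_card (filter_subset_missesBasis n (n + 1))).trans
    Simon.card_filter_missesBasis_le)).trans (two_mul_missesBasis_bound_le n)

end Summit.QuantumAdvantage.QuantumAdvantage.Theorems.SignedExactCubicForrelationNotPrBPP

end
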